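import Mathlib
import Literature.Analysis.InverseSpectral.KreinString

/-!
# Stub `stub_limitRepresentation` (crux `ContactMeasureLimit`, line `IdeatorOneSketch`)

Bookkeeping step of the Stieltjes continuity theorem for the contact kernel
`k_γ(t) = 2t/(γ²+t²)²`. Let `G` be monotone with `G = 0` on `(-∞, 0]`, `μ_G` the Lebesgue–Stieltjes
measure of `rightLim G` (`Monotone.stieltjesFunction`), `ν_G := μ_G.map (s ↦ s²)` the measure in the
squared variable `λ = s²`, and `e ≥ 0` (the escaped mass). GIVEN the layer-cake identity
`∫ (γ²+s²)⁻¹ dμ_G(s) = ∫₀^∞ G k_γ` (in `lintegral` form) and integrability of `G k_γ` on `(0, ∞)` for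
every `γ > 0`, we show:

* `(e, ν_G)` are Stieltjes-representation data (`HasStieltjesRepresentation`) for
  `q z := e + ∫ (x - z)⁻¹ dν_G(x)`: `ν_G((-∞,0)) = 0` because `s² ≥ 0`, and
  `∫ (1+λ)⁻¹ dν_G(λ) = ∫ (1+s²)⁻¹ dμ_G(s) = ∫₀^∞ G k_1 < ∞`;
* `q(-γ²) = e + ∫₀^∞ G k_γ` for every `γ > 0` (cast to a real integral, change variables `λ = s²`,
  layer cake).
-/

noncomputable section

namespace Summit.AtomisticToContinuum.FouriersLaw.Theorems.ContactMeasureLimit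

open MeasureTheory Set
open Literature.Analysis.InverseSpectral

/-- The push-forward of any measure on `ℝ` by `s ↦ s²` gives no mass to `(-∞, 0)`. -/
theorem limitRep_map_sq_Iio_zero (μ : Measure ℝ) :
    (μ.map (fun s : ℝ => s ^ 2)) (Iio 0) = 0 := by
  rw [Measure.map_apply (by fun_prop) measurableSet_Iio]
  have h : (fun s : ℝ => s ^ 2) ⁻¹' Iio (0 : ℝ) = ∅ := by
    ext s
    simp only [mem_preimage, mem_Iio, mem_empty_iff_false, iff_false, not_lt]
    exact sq_nonneg s
  rw [h, measure_empty]

/-- For a monotone `G` vanishing on `(-∞, 0]`, the integrand `G t · 2t/(γ²+t²)²` is nonnegative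
almost everywhere on `(0, ∞)`. -/
theorem limitRep_integrand_nonneg (G : ℝ → ℝ) (hG : Monotone G)
    (hG0 : ∀ s : ℝ, s ≤ 0 → G s = 0) (γ : ℝ) :
    0 ≤ᵐ[volume.restrict (Ioi (0 : ℝ))] fun t : ℝ => G t * (2 * t / (γ ^ 2 + t ^ 2) ^ 2) := by
  rw [Filter.EventuallyLE, ae_restrict_iff' measurableSet_Ioi]
  refine Filter.Eventually.of_forall fun t ht => ?_
  have ht' : (0 : ℝ) < t := ht
  have hGt : 0 ≤ G t := by
    have h := hG ht'.le
    rwa [hG0 0 le_rfl] at h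
  have hk : 0 ≤ 2 * t / (γ ^ 2 + t ^ 2) ^ 2 := by positivity
  exact mul_nonneg hGt hk

/-- The value `∫ (γ²+λ)⁻¹ dν_G(λ) = ∫₀^∞ G k_γ`: change of variables `λ = s²` (`integral_map`) and the
layer-cake identity (hypothesis), both integrals being `toReal` of the corresponding `lintegral`s. -/
theorem limitRep_integral_value (G : ℝ → ℝ) (hG : Monotone G)
    (hG0 : ∀ s : ℝ, s ≤ 0 → G s = 0) (γ : ℝ)
    (hLC : ∫⁻ s, ENNReal.ofReal ((γ ^ 2 + s ^ 2)⁻¹) ∂(hG.stieltjesFunction.measure) =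
      ∫⁻ t in Set.Ioi (0 : ℝ), ENNReal.ofReal (G t * (2 * t / (γ ^ 2 + t ^ 2) ^ 2)))
    (hInt : IntegrableOn (fun t : ℝ => G t * (2 * t / (γ ^ 2 + t ^ 2) ^ 2)) (Set.Ioi (0 : ℝ))) :
    ∫ x, (γ ^ 2 + x)⁻¹ ∂((hG.stieltjesFunction.measure).map (fun s : ℝ => s ^ 2)) =
      ∫ t in Set.Ioi (0 : ℝ), G t * (2 * t / (γ ^ 2 + t ^ 2) ^ 2) := by
  have hmeas : Measurable fun s : ℝ => s ^ 2 := by fun_prop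
  rw [integral_map hmeas.aemeasurable (Measurable.aestronglyMeasurable (by fun_prop))]
  have h1 : 0 ≤ᵐ[hG.stieltjesFunction.measure] fun s : ℝ => (γ ^ 2 + s ^ 2)⁻¹ :=
    Filter.Eventually.of_forall fun s => inv_nonneg.mpr (by positivity)
  rw [integral_eq_lintegral_of_nonneg_ae h1 (Measurable.aestronglyMeasurable (by fun_prop)), hLC,
    ← integral_eq_lintegral_of_nonneg_ae (limitRep_integrand_nonneg G hG hG0 γ)
      hInt.integrable.aestronglyMeasurable]

/-- stub A4 — LIMIT REPRESENTATION: for a monotone `G` vanishing on `(-∞,0]`, an escaped mass `e ≥ 0`,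
the layer-cake identity `∫ (γ²+s²)⁻¹ dμ_G = ∫₀^∞ G k_γ` and integrability of `G k_γ` on `(0,∞)`
(`γ > 0`), the pair `(e, ν_G)`, `ν_G := μ_G.map (s ↦ s²)`, are Stieltjes-representation data for
`z ↦ e + ∫ (x - z)⁻¹ dν_G(x)`, whose value at `z = -γ²` is `e + ∫₀^∞ G k_γ`. -/
theorem stub_limitRepresentation :
    ∀ (G : ℝ → ℝ) (hG : Monotone G), (∀ s : ℝ, s ≤ 0 → G s = 0) → ∀ e : ℝ, 0 ≤ e →
      (∀ γ : ℝ, 0 < γ →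
        ∫⁻ s, ENNReal.ofReal ((γ ^ 2 + s ^ 2)⁻¹) ∂(hG.stieltjesFunction.measure) =
          ∫⁻ t in Set.Ioi (0 : ℝ), ENNReal.ofReal (G t * (2 * t / (γ ^ 2 + t ^ 2) ^ 2))) →
      (∀ γ : ℝ, 0 < γ →
        MeasureTheory.IntegrableOn (fun t : ℝ => G t * (2 * t / (γ ^ 2 + t ^ 2) ^ 2)) (Set.Ioi (0 : ℝ))) →
      Literature.Analysis.InverseSpectral.HasStieltjesRepresentation
          (fun z : ℂ => (e : ℂ) +
            ∫ x : ℝ, ((x : ℂ) - z)⁻¹ ∂((hG.stieltjesFunction.measure).map (fun s : ℝ => s ^ 2)))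
          e ((hG.stieltjesFunction.measure).map (fun s : ℝ => s ^ 2)) ∧
        ∀ γ : ℝ, 0 < γ →
          (e : ℂ) + ∫ x : ℝ, ((x : ℂ) - (-((γ ^ 2 : ℝ) : ℂ)))⁻¹
              ∂((hG.stieltjesFunction.measure).map (fun s : ℝ => s ^ 2)) =
            ((e + ∫ t in Set.Ioi (0 : ℝ), G t * (2 * t / (γ ^ 2 + t ^ 2) ^ 2) : ℝ) : ℂ) := by
  intro G hG hG0 e he hLC hInt
  have hmeas : Measurable fun s : ℝ => s ^ 2 := by fun_prop
  refine ⟨⟨he, limitRep_map_sq_Iio_zero _, ?_, fun z _ => rfl⟩, fun γ hγ => ?_⟩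
  · -- finiteness: `∫ (1+λ)⁻¹ dν_G = ∫ (1+s²)⁻¹ dμ_G = ∫₀^∞ G k_1 < ∞`
    rw [lintegral_map (by fun_prop) hmeas]
    have h1 := hLC 1 one_pos
    have h2 := (hInt 1 one_pos).setLIntegral_lt_top
    simp only [one_pow] at h1 h2
    rw [h1]
    exact h2
  · -- the value at `z = -γ²`: cast to a real integral, change variables `λ = s²`, layer cake
    have hcongr : (fun t : ℝ => ((t : ℂ) - (-((γ ^ 2 : ℝ) : ℂ)))⁻¹) =
        fun t : ℝ => (((fun u : ℝ => (γ ^ 2 + u)⁻¹) t : ℝ) : ℂ) := by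
      funext t
      simp only [Complex.ofReal_inv]
      push_cast
      ring
    rw [hcongr, integral_complex_ofReal,
      limitRep_integral_value G hG hG0 γ (hLC γ hγ) (hInt γ hγ)]
    push_cast
    rfl

end Summit.AtomisticToContinuum.FouriersLaw.Theorems.ContactMeasureLimit

end
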